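import Summits.Ventures.DiscreteObjects.Hadamard.Order167QuaternionCocycle668

/-!
# H(668): an element of order 167 with centraliser of index 4 EXISTS iff a Williamson-type Hadamard matrix of order 668
# with circulant blocks exists (kernel iff)

Framing: lottery ticket; floor = certified bounds/negative ranges.

Cell pub-namedobj (venture DiscreteObjects), target (H), hadamard gen 21.  Sharpening of `Order167WilliamsonType668` (index 4 ⇒
a `V₄`-twisted four-circulant array with SOME sign table `θ`) to the exact Williamson array: the sign table is identified.  With
`τ_g = τ₁^{g₁} τ₂^{g₂}` (`g ∈ V₄ = ℤ/2 × ℤ/2`) and `E_g` its column-sign vector on the re-signed matrix `H'`, the construction of gen 21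
gives `H ≅ [D_g(x₀) E_g(Q_{g+h} y₀) · A_{g+h}(t − s)]`; the quaternion cocycle (`quaternion_cocycle`: `E_g(Q_k y) E_k(y) =
ε(g,k) E_{g+k}(y)`, from the nega and anticommutation relations of gen 21) rewrites `E_g(Q_{g+h} y₀) = ε(g, g+h) E_h(y₀) E_{g+h}(y₀)`,
and `ε(g, g+h) = θ_W(g,h)` is the Williamson sign table; absorbing `D_g(x₀)` into the row blocks, `E_h(y₀)` into the column
blocks (a signed equivalence, `isHadamard_resign`) and `E_k(y₀)` into `A_k` leaves EXACTLY the Williamson array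
`W(A', B', C', D') = (A B C D / −B A −D C / −C D A −B / −D −C B A)` with circulant blocks.
* **`exists_williamsonArray_of_centralizer_index_four`**: σ of pair exponent `167` non-trivial on an H(668), `τ₁, τ₂` centralising
  with distinct non-trivial involution pairs ⇒ ∃ `A' : V₄ → ℤ/167 → ℤ` such that the Williamson array of the four circulant blocks
  `A'_k` (in the `θ_W` convention of `WilliamsonArrayQuaternion668`) is a Hadamard matrix of order `668`.
* **`hadamard668_index_four_iff_williamsonType`**: **(∃ H(668) with a signed automorphism of order 167 whose centraliser contains
  two elements with distinct non-trivial involution pairs) ⇔ (∃ a Williamson-type Hadamard matrix of order 668 with circulant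
  blocks of order 167)** (converse: `williamsonArray_index_four_realized`).
* `williamsonArray_control_order4`, `williamsonArray_control_order12`: (+) controls of the sign convention by `decide` (the
  `θ_W`-array with trivial blocks is H(4); Williamson's H(12) with `A = J`, `B = C = D = 2I − J` is Hadamard).
DICTIONARY (both sides are open existence questions: Williamson-type matrices of order `4·167` are not known); H(668) untouched;
HITS 0/4.  The shape statement is the automorphism-side counterpart of the cocyclic classification over `ℤ₂² × ℤ_t` (Baliga–Horadam
1995; Horadam 2007 §6.4.3) — REPLICATION-ADJACENT in conclusion, ours in hypothesis and proof; no `sorry`, no definitions, default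
heartbeats.
-/

namespace Summit.Ventures.DiscreteObjects.Hadamard

open Finset BigOperators Matrix

open Literature.Combinatorics.Designs.GoethalsSeidel (IsHadamardMatrix)

variable {ι : Type*} [Fintype ι] [DecidableEq ι]

/-- re-signing rows and columns of a Hadamard matrix by `±1` vectors gives a Hadamard matrix (adapted from `ResignOddOrder`) -/
lemma isHadamard_resign {M : Matrix ι ι ℤ} (hM : IsHadamardMatrix M) {s t : ι → ℤ} (hs : ∀ i, s i = 1 ∨ s i = -1)
    (ht : ∀ j, t j = 1 ∨ t j = -1) : IsHadamardMatrix (Matrix.of fun i j => s i * t j * M i j) := by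
  refine ⟨?_, ?_⟩
  · intro i j
    simp only [Matrix.of_apply]
    rcases hs i with h1 | h1 <;> rcases ht j with h2 | h2 <;> rcases hM.1 i j with h3 | h3 <;> simp [h1, h2, h3]
  · ext a b
    rw [Matrix.mul_apply, Matrix.smul_apply, smul_eq_mul]
    simp only [Matrix.transpose_apply, Matrix.of_apply]
    have hab := congrFun (congrFun hM.2 a) b
    rw [Matrix.mul_apply, Matrix.smul_apply, smul_eq_mul] at hab
    simp only [Matrix.transpose_apply] at hab
    have htt : ∀ j, t j * t j = 1 := fun j => pm_mul_self (ht j)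
    calc ∑ j, s a * t j * M a j * (s b * t j * M b j)
        = s a * s b * ∑ j, (t j * t j) * (M a j * M b j) := by
          rw [Finset.mul_sum]; apply Finset.sum_congr rfl; intro j _; ring
      _ = s a * s b * ∑ j, M a j * M b j := by
          congr 1; apply Finset.sum_congr rfl; intro j _; rw [htt j, one_mul]
      _ = s a * s b * ((Fintype.card ι : ℤ) * (1 : Matrix ι ι ℤ) a b) := by rw [hab]
      _ = (Fintype.card ι : ℤ) * (1 : Matrix ι ι ℤ) a b := by
          by_cases h : a = b
          · subst h; rw [pm_mul_self (hs a), one_mul]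
          · rw [Matrix.one_apply_ne h, mul_zero, mul_zero]

section main
variable {H : Matrix ι ι ℤ} (hH : IsHadamardMatrix H) (hι : Fintype.card ι = 668)
  {π κ : Equiv.Perm ι} {d e : ι → ℤ} (haut : IsSignedAut H π κ d e)
  (hπ : π ^ 167 = 1) (hκ : κ ^ 167 = 1) (hne : π ≠ 1 ∨ κ ≠ 1)
  {π₁ κ₁ π₂ κ₂ : Equiv.Perm ι} {d₁ e₁ d₂ e₂ : ι → ℤ}
  (h₁ : IsSignedAut H π₁ κ₁ d₁ e₁) (h₂ : IsSignedAut H π₂ κ₂ d₂ e₂) (hc₁ : Commute π₁ π) (hc₁' : Commute κ₁ κ)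
  (hc₂ : Commute π₂ π) (hc₂' : Commute κ₂ κ) (hi₁ : π₁ ^ 2 = 1) (hi₁' : κ₁ ^ 2 = 1) (hi₂ : π₂ ^ 2 = 1)
  (hi₂' : κ₂ ^ 2 = 1) (hne₁ : π₁ ≠ 1 ∨ κ₁ ≠ 1) (hne₂ : π₂ ≠ 1 ∨ κ₂ ≠ 1) (hne₁₂ : π₁ ≠ π₂ ∨ κ₁ ≠ κ₂)
include hH hι haut hπ hκ hne h₁ h₂ hc₁ hc₁' hc₂ hc₂' hi₁ hi₁' hi₂ hi₂' hne₁ hne₂ hne₁₂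

/-- **Index 4 ⇒ a genuine Williamson array.**  See the module docstring. -/
theorem exists_williamsonArray_of_centralizer_index_four :
    ∃ A' : ZMod 2 × ZMod 2 → ZMod 167 → ℤ,
      IsHadamardMatrix (Matrix.of fun (a b : (ZMod 2 × ZMod 2) × ZMod 167) =>
        (if a.1 = 0 then (1 : ℤ) else if a.1 = (1, 0) then (if b.1.1 = 1 then 1 else -1)
          else if a.1 = (0, 1) then (if b.1.1 = b.1.2 then -1 else 1) else (if b.1.2 = 1 then 1 else -1)) *
        A' (a.1 + b.1) (b.2 - a.2)) := by
  have p167 : Nat.Prime 167 := by norm_num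
  have hcard : (Fintype.card ι : ℤ) ≠ 0 := by rw [hι]; norm_num
  obtain ⟨⟨hcomm, hcomm'⟩, -, -⟩ :=
    centralizer167_involutions_commute hH hι haut hπ hκ hne h₁ h₂ hc₁ hc₁' hc₂ hc₂' hi₁ hi₁' hi₂ hi₂'
  -- the sign relations of gen 21 (column side)
  obtain ⟨-, -, hN1⟩ := centralizer167_involution_nega hH hι haut hπ hκ hne h₁ hc₁ hi₁ hi₁' hne₁
  obtain ⟨-, -, hN2⟩ := centralizer167_involution_nega hH hι haut hπ hκ hne h₂ hc₂ hi₂ hi₂' hne₂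
  obtain ⟨-, hAC⟩ := centralizer167_involutions_anticommute hH hι haut hπ hκ hne h₁ h₂ hc₁ hc₁' hc₂ hc₂' hi₁ hi₁' hi₂
    hi₂' hne₁ hne₂ hne₁₂
  -- re-sign: σ is a permutation automorphism of H'
  obtain ⟨s, t, hs, ht, hH', hinv⟩ := exists_resign_of_odd hH haut (by decide : Odd 167) hπ hκ
  set H' : Matrix ι ι ℤ := Matrix.of fun i j => s i * t j * H i j with hH'def
  have hinv' : ∀ i j, H' (π i) (κ j) = H' i j := fun i j => by
    simp only [hH'def, Matrix.of_apply]; exact hinv i j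
  have hinvm : ∀ m i j, H' ((π ^ m) i) ((κ ^ m) j) = H' i j := perm_aut_pow hinv'
  have hH'ne : ∀ i j, H' i j ≠ 0 := fun i j => pm_ne_zero (hH'.1 i j)
  -- labels
  set P : ZMod 2 × ZMod 2 → Equiv.Perm ι := fun g => π₁ ^ g.1.val * π₂ ^ g.2.val with hPdef
  set Q : ZMod 2 × ZMod 2 → Equiv.Perm ι := fun g => κ₁ ^ g.1.val * κ₂ ^ g.2.val with hQdef
  set Eg : ZMod 2 × ZMod 2 → ι → ℤ := fun g j => cyc κ₁ e₁ ((κ₂ ^ g.2.val) j) g.1.val * cyc κ₂ e₂ j g.2.val with hEgdef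
  set D' : ZMod 2 × ZMod 2 → ι → ℤ := fun g i =>
    s (P g i) * s i * (cyc π₁ d₁ ((π₂ ^ g.2.val) i) g.1.val * cyc π₂ d₂ i g.2.val) with hD'def
  set E' : ZMod 2 × ZMod 2 → ι → ℤ := fun g j => t (Q g j) * t j * Eg g j with hE'def
  have hT' : ∀ g, IsSignedAut H' (P g) (Q g) (D' g) (E' g) :=
    fun g => signedAut_resign' hs ht (isSignedAut_mul (isSignedAut_pow h₁ g.1.val) (isSignedAut_pow h₂ g.2.val))
  have hcR : ∀ g, Commute (P g) π := fun g => (hc₁.pow_left _).mul_left (hc₂.pow_left _)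
  have hcC : ∀ g, Commute (Q g) κ := fun g => (hc₁'.pow_left _).mul_left (hc₂'.pow_left _)
  have hQadd : ∀ g h, Q (g + h) = Q g * Q h := fun g h => v4_label_add hi₁' hi₂' hcomm' g h
  obtain ⟨x₀⟩ : Nonempty ι := Fintype.card_pos_iff.mp (by rw [hι]; norm_num)
  set y₀ := x₀ with hy₀
  have hconst : ∀ g, (∀ k x, D' g ((π ^ k) x) = D' g x) ∧ (∀ k y, E' g ((κ ^ k) y) = E' g y) :=
    fun g => signs_const_of_commute hH'ne hinv' (by decide : Odd 167) hπ (hT' g) (hcR g) (hcC g) x₀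
  -- the quaternion cocycle at the H' level
  have hE'pm : ∀ g j, E' g j = 1 ∨ E' g j = -1 := fun g j => (hT' g).2.1 j
  have hcoc : ∀ g k y, E' g (Q k y) * E' k y =
      (if g = 0 ∨ k = 0 then (1 : ℤ) else if g = (1, 0) then (if k.1 = 1 then -1 else 1)
        else if g = (0, 1) then (if k = (1, 1) then 1 else -1) else (if k = (1, 0) then 1 else -1)) * E' (g + k) y := by
    intro g k y
    have hq := quaternion_cocycle h₁.2.1 h₂.2.1 hcomm' hi₂' hN1 hN2 hAC g k y
    have htt := pm_mul_self (ht (Q k y))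
    have hQQ : Q g (Q k y) = Q (g + k) y := by rw [hQadd]; rfl
    simp only [hE'def, hEgdef, hQdef] at hq hQQ ⊢
    rw [hQQ]
    calc t ((κ₁ ^ (g + k).1.val * κ₂ ^ (g + k).2.val) y) * t ((κ₁ ^ k.1.val * κ₂ ^ k.2.val) y) *
          (cyc κ₁ e₁ ((κ₂ ^ g.2.val) ((κ₁ ^ k.1.val * κ₂ ^ k.2.val) y)) g.1.val *
            cyc κ₂ e₂ ((κ₁ ^ k.1.val * κ₂ ^ k.2.val) y) g.2.val) *
          (t ((κ₁ ^ k.1.val * κ₂ ^ k.2.val) y) * t y * (cyc κ₁ e₁ ((κ₂ ^ k.2.val) y) k.1.val * cyc κ₂ e₂ y k.2.val))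
        = t ((κ₁ ^ (g + k).1.val * κ₂ ^ (g + k).2.val) y) * t y *
            (t ((κ₁ ^ k.1.val * κ₂ ^ k.2.val) y) * t ((κ₁ ^ k.1.val * κ₂ ^ k.2.val) y)) *
            ((cyc κ₁ e₁ ((κ₂ ^ g.2.val) ((κ₁ ^ k.1.val * κ₂ ^ k.2.val) y)) g.1.val *
                cyc κ₂ e₂ ((κ₁ ^ k.1.val * κ₂ ^ k.2.val) y) g.2.val) *
              (cyc κ₁ e₁ ((κ₂ ^ k.2.val) y) k.1.val * cyc κ₂ e₂ y k.2.val)) := by ring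
      _ = _ := by rw [htt, mul_one, hq]; ring
  -- θ(g,h) in closed form
  have hθ : ∀ g h, E' g (Q (g + h) y₀) =
      (if g = 0 then (1 : ℤ) else if g = (1, 0) then (if h.1 = 1 then 1 else -1)
        else if g = (0, 1) then (if h.1 = h.2 then -1 else 1) else (if h.2 = 1 then 1 else -1)) *
        E' h y₀ * E' (g + h) y₀ := by
    intro g h
    have hc := hcoc g (g + h) y₀
    rw [v4_facts.2.1 g h, ← thetaW_eq_cocycle g h] at hc
    have hsq := pm_mul_self (hE'pm (g + h) y₀)
    calc E' g (Q (g + h) y₀) = E' g (Q (g + h) y₀) * (E' (g + h) y₀ * E' (g + h) y₀) := by rw [hsq, mul_one]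
      _ = (E' g (Q (g + h) y₀) * E' (g + h) y₀) * E' (g + h) y₀ := by ring
      _ = _ := by rw [hc]
  -- the bijections (as in Order167WilliamsonType668)
  let fR : (ZMod 2 × ZMod 2) × ZMod 167 → ι := fun a => (π ^ a.2.val) (P a.1 x₀)
  let fC : (ZMod 2 × ZMod 2) × ZMod 167 → ι := fun b => (κ ^ b.2.val) (Q b.1 y₀)
  have hcardV : Fintype.card ((ZMod 2 × ZMod 2) × ZMod 167) = 668 := by simp [ZMod.card]
  have hbR : Function.Bijective fR := by
    rw [Fintype.bijective_iff_injective_and_card]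
    exact ⟨v4_orbitMap_injective hH hι haut hπ hκ hne h₁ h₂ hc₁ hc₁' hc₂ hc₂' hi₁ hi₁' hi₂ hi₂' hne₁ hne₂ hne₁₂ x₀,
      by rw [hcardV, hι]⟩
  have hbC : Function.Bijective fC := by
    rw [Fintype.bijective_iff_injective_and_card]
    refine ⟨?_, by rw [hcardV, hι]⟩
    have hT := isHadamard_transpose hH hcard
    exact v4_orbitMap_injective hT hι (isSignedAut_transpose haut) hκ hπ hne.symm (isSignedAut_transpose h₁)
      (isSignedAut_transpose h₂) hc₁' hc₁ hc₂' hc₂ hi₁' hi₁ hi₂' hi₂ hne₁.symm hne₂.symm hne₁₂.symm y₀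
  let ER : (ZMod 2 × ZMod 2) × ZMod 167 ≃ ι := Equiv.ofBijective fR hbR
  let EC : (ZMod 2 × ZMod 2) × ZMod 167 ≃ ι := Equiv.ofBijective fC hbC
  -- the reindexed matrix M and its entries
  have hentry : ∀ a b : (ZMod 2 × ZMod 2) × ZMod 167,
      H' (ER a) (EC b) = D' a.1 x₀ * E' a.1 (Q (a.1 + b.1) y₀) * H' x₀ ((κ ^ (b.2 - a.2).val) (Q (a.1 + b.1) y₀)) := by
    rintro ⟨g, s'⟩ ⟨h, t'⟩
    show H' ((π ^ s'.val) (P g x₀)) ((κ ^ t'.val) (Q h y₀)) =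
      D' g x₀ * E' g (Q (g + h) y₀) * H' x₀ ((κ ^ (t' - s').val) (Q (g + h) y₀))
    have hQh : Q h = Q g * Q (g + h) := by rw [← hQadd, v4_facts.2.1]
    have e1 : (κ ^ t'.val) (Q h y₀) = Q g ((κ ^ t'.val) (Q (g + h) y₀)) := by
      rw [hQh, Equiv.Perm.mul_apply (Q g) (Q (g + h)), ← Equiv.Perm.mul_apply (κ ^ t'.val) (Q g),
        ← ((hcC g).pow_right t'.val).eq, Equiv.Perm.mul_apply]
    have e2 : (π ^ s'.val) (P g x₀) = P g ((π ^ s'.val) x₀) := by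
      rw [← Equiv.Perm.mul_apply, ← ((hcR g).pow_right s'.val).eq, Equiv.Perm.mul_apply]
    rw [e1, e2, (hT' g).2.2, (hconst g).1, (hconst g).2]
    have e3 : (κ ^ t'.val) (Q (g + h) y₀) = (κ ^ s'.val) ((κ ^ (t' - s').val) (Q (g + h) y₀)) := by
      rw [← Equiv.Perm.mul_apply (κ ^ s'.val) (κ ^ (t' - s').val), ← pow_add,
        ← pow_mod_of_pow_eq_one κ hκ (s'.val + (t' - s').val), ← ZMod.val_add, add_sub_cancel]
    rw [e3, hinvm]
  have hMhad : IsHadamardMatrix (H'.submatrix ER EC) := by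
    refine ⟨fun a b => hH'.1 _ _, ?_⟩
    rw [Matrix.transpose_submatrix, Matrix.submatrix_mul_equiv, hH'.2]
    ext a b
    rw [Matrix.submatrix_apply, Matrix.smul_apply, Matrix.one_apply, Matrix.smul_apply, Matrix.one_apply, hι]
    simp only [EmbeddingLike.apply_eq_iff_eq]
    simp [ZMod.card]
  -- the Williamson array of A' is the re-signed M
  refine ⟨fun k r => E' k y₀ * H' x₀ ((κ ^ r.val) (Q k y₀)), ?_⟩
  have hW : (Matrix.of fun (a b : (ZMod 2 × ZMod 2) × ZMod 167) =>
        (if a.1 = 0 then (1 : ℤ) else if a.1 = (1, 0) then (if b.1.1 = 1 then 1 else -1)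
          else if a.1 = (0, 1) then (if b.1.1 = b.1.2 then -1 else 1) else (if b.1.2 = 1 then 1 else -1)) *
        (E' (a.1 + b.1) y₀ * H' x₀ ((κ ^ (b.2 - a.2).val) (Q (a.1 + b.1) y₀)))) =
      Matrix.of fun a b => D' a.1 x₀ * E' b.1 y₀ * (H'.submatrix ER EC) a b := by
    ext a b
    rw [Matrix.of_apply, Matrix.of_apply, Matrix.submatrix_apply, hentry, hθ]
    have hdd := pm_mul_self ((hT' a.1).1 x₀)
    have hee := pm_mul_self (hE'pm b.1 y₀)
    -- both sides agree after using D'² = E'² = 1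
    set θv := (if a.1 = 0 then (1 : ℤ) else if a.1 = (1, 0) then (if b.1.1 = 1 then 1 else -1)
          else if a.1 = (0, 1) then (if b.1.1 = b.1.2 then -1 else 1) else (if b.1.2 = 1 then 1 else -1)) with hθv
    calc θv * (E' (a.1 + b.1) y₀ * H' x₀ ((κ ^ (b.2 - a.2).val) (Q (a.1 + b.1) y₀)))
        = θv * (E' (a.1 + b.1) y₀ * H' x₀ ((κ ^ (b.2 - a.2).val) (Q (a.1 + b.1) y₀))) *
            ((D' a.1 x₀ * D' a.1 x₀) * (E' b.1 y₀ * E' b.1 y₀)) := by rw [hdd, hee, mul_one, mul_one]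
      _ = D' a.1 x₀ * E' b.1 y₀ * (D' a.1 x₀ * (θv * E' b.1 y₀ * E' (a.1 + b.1) y₀) *
            H' x₀ ((κ ^ (b.2 - a.2).val) (Q (a.1 + b.1) y₀))) := by ring
  rw [hW]
  exact isHadamard_resign hMhad (fun a => (hT' a.1).1 x₀) (fun b => hE'pm b.1 y₀)

end main

/-- **Index 4 at an element of order 167 ⇔ a Williamson-type H(668) with circulant blocks.** -/
theorem hadamard668_index_four_iff_williamsonType :
    (∃ (ι : Type) (_ : Fintype ι) (_ : DecidableEq ι) (H : Matrix ι ι ℤ) (π κ π₁ κ₁ π₂ κ₂ : Equiv.Perm ι)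
        (d e d₁ e₁ d₂ e₂ : ι → ℤ), Fintype.card ι = 668 ∧ IsHadamardMatrix H ∧ IsSignedAut H π κ d e ∧ π ^ 167 = 1 ∧
        κ ^ 167 = 1 ∧ (π ≠ 1 ∨ κ ≠ 1) ∧ IsSignedAut H π₁ κ₁ d₁ e₁ ∧ IsSignedAut H π₂ κ₂ d₂ e₂ ∧ Commute π₁ π ∧ Commute κ₁ κ ∧
        Commute π₂ π ∧ Commute κ₂ κ ∧ π₁ ^ 2 = 1 ∧ κ₁ ^ 2 = 1 ∧ π₂ ^ 2 = 1 ∧ κ₂ ^ 2 = 1 ∧ (π₁ ≠ 1 ∨ κ₁ ≠ 1) ∧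
        (π₂ ≠ 1 ∨ κ₂ ≠ 1) ∧ (π₁ ≠ π₂ ∨ κ₁ ≠ κ₂)) ↔
    ∃ A : ZMod 2 × ZMod 2 → ZMod 167 → ℤ,
      IsHadamardMatrix (Matrix.of fun (a b : (ZMod 2 × ZMod 2) × ZMod 167) =>
        (if a.1 = 0 then (1 : ℤ) else if a.1 = (1, 0) then (if b.1.1 = 1 then 1 else -1)
          else if a.1 = (0, 1) then (if b.1.1 = b.1.2 then -1 else 1) else (if b.1.2 = 1 then 1 else -1)) *
        A (a.1 + b.1) (b.2 - a.2)) := by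
  constructor
  · rintro ⟨ι, _, _, H, π, κ, π₁, κ₁, π₂, κ₂, d, e, d₁, e₁, d₂, e₂, hι, hH, haut, hπ, hκ, hne, h₁, h₂, hc₁, hc₁', hc₂, hc₂',
      hi₁, hi₁', hi₂, hi₂', hne₁, hne₂, hne₁₂⟩
    exact exists_williamsonArray_of_centralizer_index_four hH hι haut hπ hκ hne h₁ h₂ hc₁ hc₁' hc₂ hc₂' hi₁ hi₁' hi₂ hi₂'
      hne₁ hne₂ hne₁₂
  · rintro ⟨A, hW⟩
    obtain ⟨M, π, κ, π₁, κ₁, π₂, κ₂, d, e, d₁, e₁, d₂, e₂, hM, hcard, haut, hπ, hκ, hne, h₁, h₂, hc₁, hc₁', hc₂, hc₂', hi₁,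
      hi₁', hi₂, hi₂', hne₁, hne₂, hne₁₂⟩ := williamsonArray_index_four_realized A hW
    exact ⟨(ZMod 2 × ZMod 2) × ZMod 167, inferInstance, inferInstance, M, π, κ, π₁, κ₁, π₂, κ₂, d, e, d₁, e₁, d₂, e₂, hcard,
      hM, haut, hπ, hκ, hne, h₁, h₂, hc₁, hc₁', hc₂, hc₂', hi₁, hi₁', hi₂, hi₂', hne₁, hne₂, hne₁₂⟩

/-! ### controls of the sign convention (small orders, `decide`) -/

/-- **(+) control, order 4**: with `1 × 1` blocks all equal to `1` the Williamson array of the `θ_W` convention is a Hadamard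
matrix of order `4`. -/
theorem williamsonArray_control_order4 :
    IsHadamardMatrix (Matrix.of fun (a b : (ZMod 2 × ZMod 2) × ZMod 1) =>
      (if a.1 = 0 then (1 : ℤ) else if a.1 = (1, 0) then (if b.1.1 = 1 then 1 else -1)
        else if a.1 = (0, 1) then (if b.1.1 = b.1.2 then -1 else 1) else (if b.1.2 = 1 then 1 else -1)) *
      (fun (_ : ZMod 2 × ZMod 2) (_ : ZMod 1) => (1 : ℤ)) (a.1 + b.1) (b.2 - a.2)) := by
  unfold IsHadamardMatrix
  decide

set_option maxRecDepth 100000 in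
/-- **(+) control, order 12**: Williamson's `H(12)` — circulant blocks `A = J₃`, `B = C = D = 2I − J₃` (first rows `(1,1,1)` and
`(1,−1,−1)`) — in the `θ_W` convention is a Hadamard matrix of order `12` (the right-hand side of the iff is inhabited at
`w = 3`; at `w = 167` it is the open Williamson-type question). -/
theorem williamsonArray_control_order12 :
    IsHadamardMatrix (Matrix.of fun (a b : (ZMod 2 × ZMod 2) × ZMod 3) =>
      (if a.1 = 0 then (1 : ℤ) else if a.1 = (1, 0) then (if b.1.1 = 1 then 1 else -1)
        else if a.1 = (0, 1) then (if b.1.1 = b.1.2 then -1 else 1) else (if b.1.2 = 1 then 1 else -1)) *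
      (fun (k : ZMod 2 × ZMod 2) (r : ZMod 3) => if k = 0 then (1 : ℤ) else if r = 0 then 1 else -1) (a.1 + b.1)
        (b.2 - a.2)) := by
  unfold IsHadamardMatrix
  decide

end Summit.Ventures.DiscreteObjects.Hadamard
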